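import Mathlib
import HarnessLib
import Literature.NumberTheory.Sieve.BatemanHorn
import Literature.NumberTheory.Sieve.BatemanHornProofs
import Literature.NumberTheory.Sieve.BatemanHornLocalCounts
import Literature.NumberTheory.Sieve.ParityWave0SchinzelBatemanHornProofs
import Summits.Parity.BatemanHorn.Theorems.AlmostPrimeZerosSystemZeroRepulsionLocalFactor
import Summits.Parity.BatemanHorn.Theorems.AlmostPrimeZerosSystemZeroRepulsionEulerBoundReal

/-!
# Smooth periodic factorisation of the almost-prime statistic (stub `stub_smoothPeriodicFactorisation`)

Line `smooth-rough-lattice-acquisition` of crux stmt-Parity-11291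
(`Summit.Parity.BatemanHorn.Theses.AlmostPrimeZeros.SystemZeroRepulsion`), stub S4 — Stage C
(CRT factorisation) and Stage D (assembly), importing Stage A (`stub_localFactorLaw`, the law of the
local pattern) and Stage B (`stub_eulerProductBounds`, the two Euler-product bounds).

Notation: `L = log log x` (also the smooth threshold `y = ⌊L⌋₊`), `L₃ = log L`,
`Q = ∏_{p ≤ y} p²`, `s_f(n) = Σ_i Σ_{p^v ∥ f_i(n)} min(v,2)` (capped statistic),
`s♯_x(n)` its rough part (primes `p > L`), `π_p(b) = Σ_i ([p ∣ f_i(b)] + [p² ∣ f_i(b)])` the local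
pattern, `sm(n) = Σ_{p ≤ y} π_p(n)` the smooth pattern, `E_p(w) = Σ_{b < p²} w^{π_p(b)}`.

Proof of S4.  Let `m₀` be such that `f_i(n) ≥ 1` for all `i` and `n ≥ m₀`.  For `n ≥ m₀`,
`min(v_p(f_i(n)), 2) = [p ∣ f_i(n)] + [p² ∣ f_i(n)]`, so `s_f(n) = sm(n) + s♯_x(n)`, and `sm` is
`Q`-periodic (`Polynomial.sub_dvd_eval_sub`).  Hence, with `ι = {(Q, a) : a < Q}` and
`c_{(Q,a)} = z^{sm(a)}`, `Σ_{m₀ ≤ n ≤ x} z^{s_f(n)} = Σ_a c_{(Q,a)} ClassSum(Q, a)` exactly, and (E) is the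
bound `‖Σ_{n < m₀} z^{s_f(n)}‖ ≤ m₀ (1 + 3L)^σ ≤ x (log x)^{−3kL} ≤ x (log x)^{k(Re z − 1)}` for
`L ≥ 6(m₀ + 3σ + 3k)` (`σ = Σ_{n<m₀} s_f(n)`, `e^L ≥ L³/6`).  By the Chinese remainder theorem
`Σ_{a < Q} w^{sm(a)} = ∏_{p ≤ y} E_p(w)`, so `Σ_q c_q/q.1 = ∏_{p ≤ y} E_p(z)/p²` and
`Σ_q ‖c_q‖/q.1 = ∏_{p ≤ y} E_p(‖z‖)/p²`, and (Λ), (B) are Stage B at `Y = L`.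
-/

noncomputable section

namespace Summit.Parity.BatemanHorn.Cruxes.SystemZeroRepulsion.SmoothRoughLatticeAcquisition

open Finset

/-! ### Stage C: the Chinese remainder theorem as a product formula -/

/-- CRT reindexing: for coprime `m, n` the map `a ↦ (a mod m, a mod n)` is a bijection from
`{0, …, mn − 1}` onto `{0, …, m − 1} × {0, …, n − 1}`. -/
private theorem sum_range_mul_eq_sum_product {R : Type*} [AddCommMonoid R] {m n : ℕ}
    (h : Nat.Coprime m n) (G : ℕ × ℕ → R) :
    ∑ a ∈ range (m * n), G (a % m, a % n) = ∑ bc ∈ range m ×ˢ range n, G bc := by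
  classical
  have hinj : Set.InjOn (fun a : ℕ => (a % m, a % n)) (range (m * n) : Set ℕ) := by
    intro a ha a' ha' he
    simp only [Prod.mk.injEq] at he
    rw [coe_range, Set.mem_Iio] at ha ha'
    exact Nat.ModEq.eq_of_lt_of_lt ((Nat.modEq_and_modEq_iff_modEq_mul h).1 ⟨he.1, he.2⟩) ha ha'
  have himage : (range (m * n)).image (fun a : ℕ => (a % m, a % n)) = range m ×ˢ range n := by
    apply eq_of_subset_of_card_le
    · intro x hx
      simp only [mem_image, mem_range] at hx
      obtain ⟨a, ha, rfl⟩ := hx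
      have hm : 0 < m := Nat.pos_of_ne_zero fun h0 => by simp [h0] at ha
      have hn : 0 < n := Nat.pos_of_ne_zero fun h0 => by simp [h0] at ha
      simp [Nat.mod_lt _ hm, Nat.mod_lt _ hn]
    · rw [card_image_of_injOn hinj, card_product, card_range, card_range, card_range]
  rw [← himage, sum_image hinj]

/-- CRT product formula: for pairwise coprime moduli `m_p` (`p ∈ S`) and `m_p`-periodic weights
`w_p`, `Σ_{a < ∏ m_p} ∏_p w_p(a) = ∏_p Σ_{b < m_p} w_p(b)`. -/
private theorem sum_range_prod_eq_prod_sum {R : Type*} [CommSemiring R] (S : Finset ℕ) (m : ℕ → ℕ)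
    (hcop : ∀ p ∈ S, ∀ q ∈ S, p ≠ q → Nat.Coprime (m p) (m q))
    (w : ℕ → ℕ → R) (hw : ∀ p ∈ S, ∀ a, w p a = w p (a % m p)) :
    ∑ a ∈ range (∏ p ∈ S, m p), ∏ p ∈ S, w p a = ∏ p ∈ S, ∑ b ∈ range (m p), w p b := by
  classical
  induction S using Finset.induction_on with
  | empty => simp
  | insert q S hq ih =>
    have hcopS : ∀ p ∈ S, ∀ p' ∈ S, p ≠ p' → Nat.Coprime (m p) (m p') := fun p hp p' hp' hne =>
      hcop p (mem_insert_of_mem hp) p' (mem_insert_of_mem hp') hne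
    have hwS : ∀ p ∈ S, ∀ a, w p a = w p (a % m p) := fun p hp => hw p (mem_insert_of_mem hp)
    have hco : Nat.Coprime (m q) (∏ p ∈ S, m p) :=
      Nat.Coprime.prod_right fun p hp => hcop q (mem_insert_self q S) p (mem_insert_of_mem hp)
        fun h => hq (h ▸ hp)
    have key : ∀ a, w q a * ∏ p ∈ S, w p a =
        w q (a % m q) * ∏ p ∈ S, w p (a % ∏ p ∈ S, m p) := by
      intro a
      rw [← hw q (mem_insert_self q S)]
      congr 1
      refine prod_congr rfl fun p hp => ?_
      rw [hwS p hp a, hwS p hp (a % ∏ p ∈ S, m p), Nat.mod_mod_of_dvd _ (dvd_prod_of_mem m hp)]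
    rw [prod_insert hq, prod_insert hq]
    simp_rw [prod_insert hq]
    calc ∑ a ∈ range (m q * ∏ p ∈ S, m p), w q a * ∏ p ∈ S, w p a
        = ∑ a ∈ range (m q * ∏ p ∈ S, m p),
            (fun bc : ℕ × ℕ => w q bc.1 * ∏ p ∈ S, w p bc.2) (a % m q, a % ∏ p ∈ S, m p) :=
          sum_congr rfl fun a _ => key a
      _ = ∑ bc ∈ range (m q) ×ˢ range (∏ p ∈ S, m p), w q bc.1 * ∏ p ∈ S, w p bc.2 :=
          sum_range_mul_eq_sum_product hco (fun bc : ℕ × ℕ => w q bc.1 * ∏ p ∈ S, w p bc.2)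
      _ = (∑ b ∈ range (m q), w q b) * ∑ c ∈ range (∏ p ∈ S, m p), ∏ p ∈ S, w p c := by
          rw [sum_product, sum_mul_sum]
      _ = (∑ b ∈ range (m q), w q b) * ∏ p ∈ S, ∑ b ∈ range (m p), w p b := by
          rw [ih hcopS hwS]

/-- If `d ∣ m` then `d ∣ g(n) ↔ d ∣ g(n mod m)` (`(n − n mod m) ∣ g(n) − g(n mod m)`). -/
private theorem dvd_eval_iff_dvd_eval_mod (g : Polynomial ℤ) {d : ℤ} {m : ℕ} (hd : d ∣ (m : ℤ))
    (n : ℕ) : d ∣ g.eval (n : ℤ) ↔ d ∣ g.eval ((n % m : ℕ) : ℤ) := by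
  have h1 : (m : ℤ) ∣ (n : ℤ) - ((n % m : ℕ) : ℤ) := by
    rw [← Nat.cast_sub (Nat.mod_le n m)]
    exact Int.natCast_dvd_natCast.2 (Nat.dvd_sub_mod n)
  exact dvd_iff_dvd_of_dvd_sub ((hd.trans h1).trans (Polynomial.sub_dvd_eval_sub _ _ g))

/-- Periodicity of the local pattern: if `p² ∣ m` then `π_p(n) = π_p(n mod m)`. -/
private theorem locPat_mod {k : ℕ} (f : Fin k → Polynomial ℤ) {p m : ℕ} (h : (p : ℤ) ^ 2 ∣ (m : ℤ))
    (n : ℕ) :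
    (∑ i, ((if (p : ℤ) ∣ (f i).eval (n : ℤ) then 1 else 0) +
        (if (p : ℤ) ^ 2 ∣ (f i).eval (n : ℤ) then 1 else 0)) : ℕ) =
      ∑ i, ((if (p : ℤ) ∣ (f i).eval ((n % m : ℕ) : ℤ) then 1 else 0) +
        (if (p : ℤ) ^ 2 ∣ (f i).eval ((n % m : ℕ) : ℤ) then 1 else 0)) := by
  have h1 : (p : ℤ) ∣ (m : ℤ) := (dvd_pow_self (p : ℤ) two_ne_zero).trans h
  refine sum_congr rfl fun i _ => ?_
  simp only [dvd_eval_iff_dvd_eval_mod (f i) h1 n, dvd_eval_iff_dvd_eval_mod (f i) h n]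

/-- CRT for the smooth weights: `Σ_{a < Q} w^{sm(a)} = ∏_{p ≤ y} E_p(w)` with `Q = ∏_{p ≤ y} p²`,
`sm(a) = Σ_{p ≤ y} π_p(a)`, for `w` in any commutative semiring. -/
private theorem crt_euler {k : ℕ} (f : Fin k → Polynomial ℤ) (y : ℕ) {R : Type*} [CommSemiring R]
    (w : R) :
    ∑ a ∈ range (∏ p ∈ Nat.primesLE y, p ^ 2),
        w ^ (∑ p ∈ Nat.primesLE y, ∑ i, ((if (p : ℤ) ∣ (f i).eval (a : ℤ) then 1 else 0) +
          (if (p : ℤ) ^ 2 ∣ (f i).eval (a : ℤ) then 1 else 0)) : ℕ) =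
      ∏ p ∈ Nat.primesLE y, ∑ b ∈ range (p ^ 2),
        w ^ (∑ i, ((if (p : ℤ) ∣ (f i).eval (b : ℤ) then 1 else 0) +
          (if (p : ℤ) ^ 2 ∣ (f i).eval (b : ℤ) then 1 else 0)) : ℕ) := by
  have hcop : ∀ p ∈ Nat.primesLE y, ∀ q ∈ Nat.primesLE y, p ≠ q → Nat.Coprime (p ^ 2) (q ^ 2) :=
    fun p hp q hq hne => Nat.Coprime.pow 2 2
      ((Nat.coprime_primes (Nat.mem_primesLE.1 hp).2 (Nat.mem_primesLE.1 hq).2).2 hne)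
  rw [← sum_range_prod_eq_prod_sum (Nat.primesLE y) (fun p => p ^ 2) hcop
    (fun p a => w ^ (∑ i, ((if (p : ℤ) ∣ (f i).eval (a : ℤ) then 1 else 0) +
      (if (p : ℤ) ^ 2 ∣ (f i).eval (a : ℤ) then 1 else 0)) : ℕ))
    (fun p _ a => by rw [locPat_mod f (dvd_of_eq (Nat.cast_pow p 2).symm) a])]
  exact sum_congr rfl fun a _ => (prod_pow_eq_pow_sum _ _ _).symm

/-! ### Stage C: the capped valuation pattern and the factorisation over residue classes -/

/-- `min(v_p(N), 2) = [p ∣ N] + [p² ∣ N]` for `N ≠ 0`. -/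
private theorem min_factorization_two {N p : ℕ} (hN : N ≠ 0) (hp : p.Prime) :
    min (N.factorization p) 2 = (if p ∣ N then 1 else 0) + (if p ^ 2 ∣ N then 1 else 0) := by
  have h1 : p ∣ N ↔ 1 ≤ N.factorization p := by
    rw [← hp.pow_dvd_iff_le_factorization hN, pow_one]
  have h2 : p ^ 2 ∣ N ↔ 2 ≤ N.factorization p := hp.pow_dvd_iff_le_factorization hN
  by_cases c2 : 2 ≤ N.factorization p
  · rw [if_pos (h1.2 (by omega)), if_pos (h2.2 c2), min_eq_right c2]
  · by_cases c1 : 1 ≤ N.factorization p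
    · rw [if_pos (h1.2 c1), if_neg fun h => c2 (h2.1 h)]
      omega
    · rw [if_neg fun h => c1 (h1.1 h), if_neg fun h => c2 (h2.1 h)]
      omega

/-- Splitting the capped statistic of `N ≠ 0` at the threshold `L`: the smooth part is
`Σ_{p ≤ ⌊L⌋} ([p ∣ N] + [p² ∣ N])`, the rough part keeps the primes `p > L`. -/
private theorem factorization_sum_split {N : ℕ} (hN : N ≠ 0) (L : ℝ) :
    (N.factorization.sum fun _ v => min v 2) =
      (∑ p ∈ Nat.primesLE ⌊L⌋₊, ((if p ∣ N then 1 else 0) + (if p ^ 2 ∣ N then 1 else 0))) +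
        N.factorization.sum fun p v => if L < (p : ℝ) then min v 2 else 0 := by
  classical
  have hsplit : (N.factorization.sum fun _ v => min v 2) =
      (N.factorization.sum fun p v => if L < (p : ℝ) then 0 else min v 2) +
        N.factorization.sum fun p v => if L < (p : ℝ) then min v 2 else 0 := by
    rw [← Finsupp.sum_add]
    congr 1
    funext p v
    split_ifs <;> simp
  rw [hsplit]
  congr 1
  unfold Finsupp.sum
  rw [Nat.support_factorization, sum_ite, sum_const_zero, zero_add]
  refine sum_subset_zero_on_sdiff ?_ ?_ ?_
  · intro p hp
    rw [mem_filter, Nat.mem_primeFactors, not_lt] at hp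
    exact Nat.mem_primesLE.2 ⟨(Nat.le_floor_iff' hp.1.1.ne_zero).2 hp.2, hp.1.1⟩
  · intro p hp
    rw [mem_sdiff, Nat.mem_primesLE, mem_filter, Nat.mem_primeFactors, not_lt] at hp
    have hnd : ¬p ∣ N := fun hd =>
      hp.2 ⟨⟨hp.1.2, hd, hN⟩, (Nat.le_floor_iff' hp.1.2.ne_zero).1 hp.1.1⟩
    rw [if_neg hnd, if_neg fun hd => hnd ((dvd_pow_self p two_ne_zero).trans hd)]
    rfl
  · intro p hp
    rw [mem_filter, Nat.mem_primeFactors] at hp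
    exact min_factorization_two hN hp.1.1

/-- Abstract factorisation over residue classes: if `s = sm + sr` on `[m₀, ∞)` and `sm` is
`Q`-periodic then `Σ_{m₀ ≤ n < N} z^{s(n)} = Σ_{a < Q} z^{sm(a)} Σ_{m₀ ≤ n < N, n ≡ a (Q)} z^{sr(n)}`. -/
private theorem sum_Ico_eq_sum_classes {m₀ N Q : ℕ} (hQ : 0 < Q) (s sm sr : ℕ → ℕ)
    (hs : ∀ n, m₀ ≤ n → s n = sm n + sr n) (hper : ∀ n, sm n = sm (n % Q)) (z : ℂ) :
    ∑ n ∈ Ico m₀ N, z ^ s n =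
      ∑ a ∈ range Q, z ^ sm a *
        ∑ n ∈ (Ico m₀ N).filter (fun n : ℕ => n ≡ a [MOD Q]), z ^ sr n := by
  rw [← sum_fiberwise_of_maps_to (s := Ico m₀ N) (t := range Q) (g := fun n => n % Q)
    (fun n _ => mem_range.2 (Nat.mod_lt n hQ))]
  refine sum_congr rfl fun a ha => ?_
  have haQ : a % Q = a := Nat.mod_eq_of_lt (mem_range.1 ha)
  rw [mul_sum]
  have hfilter : (Ico m₀ N).filter (fun n => n % Q = a) =
      (Ico m₀ N).filter (fun n : ℕ => n ≡ a [MOD Q]) :=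
    filter_congr fun n _ => by rw [Nat.ModEq, haQ]
  rw [hfilter]
  refine sum_congr rfl fun n hn => ?_
  rw [mem_filter, mem_Ico] at hn
  have hna : n % Q = a := by
    have h := hn.2
    unfold Nat.ModEq at h
    rw [h, haQ]
  rw [hs n hn.1.1, pow_add, hper n, hna]

/-- The tail `Σ_{n < m₀} z^{s(n)}` has norm at most `m₀ B^{Σ_{n<m₀} s(n)}` when `‖z‖ ≤ B`, `1 ≤ B`. -/
private theorem norm_sum_range_pow_le (s : ℕ → ℕ) (m₀ : ℕ) {z : ℂ} {B : ℝ} (hB : 1 ≤ B)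
    (hz : ‖z‖ ≤ B) : ‖∑ n ∈ range m₀, z ^ s n‖ ≤ m₀ * B ^ (∑ n ∈ range m₀, s n) := by
  calc ‖∑ n ∈ range m₀, z ^ s n‖ ≤ ∑ n ∈ range m₀, ‖z ^ s n‖ := norm_sum_le _ _
    _ ≤ ∑ n ∈ range m₀, B ^ (∑ n ∈ range m₀, s n) := sum_le_sum fun n hn => by
        rw [norm_pow]
        exact (pow_le_pow_left₀ (norm_nonneg _) hz _).trans
          (pow_le_pow_right₀ hB (single_le_sum (f := s) (fun _ _ => Nat.zero_le _) hn))
    _ = m₀ * B ^ (∑ n ∈ range m₀, s n) := by rw [sum_const, card_range, nsmul_eq_mul]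

/-- The tail estimate (E): `m₀ (1 + 3L)^σ ≤ x (log x)^{k a}` once `L = log log x ≥ 1`,
`L ≥ 6(m₀ + 3σ + 3k)` and `a ≥ −3L` (`e^L ≥ L³/6`). -/
private theorem tail_le {m₀ σ k : ℕ} {x L a : ℝ} (hx : 1 < x) (hL : L = Real.log (Real.log x))
    (hL1 : 1 ≤ L) (hL0 : 6 * ((m₀ : ℝ) + 3 * σ + 3 * k) ≤ L) (ha : -(3 * L) ≤ a) :
    (m₀ : ℝ) * (1 + 3 * L) ^ σ ≤ x * Real.log x ^ ((k : ℝ) * a) := by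
  have hlogpos : 0 < Real.log x := Real.log_pos hx
  have hlogx : Real.log x = Real.exp L := by rw [hL, Real.exp_log hlogpos]
  have hx' : x = Real.exp (Real.exp L) := by rw [← hlogx, Real.exp_log (by linarith)]
  have hk : (0 : ℝ) ≤ k := Nat.cast_nonneg k
  have hL00 : 0 ≤ L := by linarith
  have h1 : Real.exp (-(3 * k * L * L)) ≤ Real.log x ^ ((k : ℝ) * a) := by
    rw [hlogx, ← Real.exp_mul]
    apply Real.exp_le_exp.2
    have : (k : ℝ) * (-(3 * L)) ≤ k * a := mul_le_mul_of_nonneg_left ha hk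
    nlinarith
  have h2 : (m₀ : ℝ) ≤ Real.exp m₀ := by linarith [Real.add_one_le_exp (m₀ : ℝ)]
  have h3 : (1 + 3 * L) ^ σ ≤ Real.exp (σ * (3 * L)) := by
    rw [Real.exp_nat_mul]
    exact pow_le_pow_left₀ (by positivity) (by linarith [Real.add_one_le_exp (3 * L)]) σ
  have h4 : L ^ 3 / 6 ≤ Real.exp L := by
    have := Real.pow_div_factorial_le_exp L hL00 3
    simpa [Nat.factorial] using this
  have h5 : (m₀ : ℝ) + σ * (3 * L) + 3 * k * L * L ≤ Real.exp L := by
    have hM : ((m₀ : ℝ) + 3 * σ + 3 * k) * L ^ 2 ≤ L ^ 3 / 6 := by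
      have := mul_le_mul_of_nonneg_right hL0 (sq_nonneg L)
      nlinarith
    have hσ : (0 : ℝ) ≤ σ := Nat.cast_nonneg σ
    have hm : (0 : ℝ) ≤ m₀ := Nat.cast_nonneg m₀
    have hL2 : L ≤ L ^ 2 := by nlinarith
    have h1L : 1 ≤ L ^ 2 := by nlinarith
    nlinarith [mul_le_mul_of_nonneg_left hL2 hσ, mul_le_mul_of_nonneg_left h1L hm]
  calc (m₀ : ℝ) * (1 + 3 * L) ^ σ ≤ Real.exp m₀ * Real.exp (σ * (3 * L)) :=
        mul_le_mul h2 h3 (by positivity) (by positivity)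
    _ = Real.exp (m₀ + σ * (3 * L)) := (Real.exp_add _ _).symm
    _ ≤ Real.exp (Real.exp L + -(3 * k * L * L)) := Real.exp_le_exp.2 (by linarith)
    _ = Real.exp (Real.exp L) * Real.exp (-(3 * k * L * L)) := Real.exp_add _ _
    _ ≤ x * Real.log x ^ ((k : ℝ) * a) := by
        rw [← hx']
        exact mul_le_mul_of_nonneg_left h1 (by positivity)

/-! ### Stage D: the registered theorem -/

/-- **S4 `stub_smoothPeriodicFactorisation`** — exact CRT factorisation of the smooth weights of the
capped almost-prime statistic modulo `Q = ∏_{p ≤ log log x} p²`, with the two Euler-product bounds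
(Λ), (B) consumed by the resummation S7.  See the module docstring for the proof. -/
theorem stub_smoothPeriodicFactorisation :
    ∀ (k : ℕ) (f : Fin k → Polynomial ℤ), Literature.NumberTheory.Sieve.IsBatemanHornSystem f →
      ∃ m₀ : ℕ, ∃ A C : ℝ, ∃ x₀ : ℕ, ∀ x : ℕ, x₀ ≤ x → ∀ z : ℂ, ‖z - 1‖ ≤ 3 * Real.log (Real.log (x : ℝ)) →
        ∃ (ι : Finset (ℕ × ℕ)) (c : ℕ × ℕ → ℂ),
          (∀ q ∈ ι, 0 < q.1 ∧ q.1 ∣ (∏ p ∈ Nat.primesLE ⌊Real.log (Real.log (x : ℝ))⌋₊, p ^ 2)) ∧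
          ‖(∑ n ∈ Finset.range (x + 1), (z : ℂ) ^ (∑ i, (((f i).eval (n : ℤ)).toNat.factorization.sum fun _ v => min v 2))) -
              ∑ q ∈ ι, c q * (∑ n ∈ (Finset.Ico m₀ (x + 1)).filter (fun n : ℕ => n ≡ q.2 [MOD q.1]), (z : ℂ) ^ (∑ i, (((f i).eval (n : ℤ)).toNat.factorization.sum fun p v => if Real.log (Real.log (x : ℝ)) < (p : ℝ) then min v 2 else 0)))‖ ≤
            (x : ℝ) * (Real.log (x : ℝ)) ^ ((k : ℝ) * (z.re - 1)) ∧
          ‖∑ q ∈ ι, c q / (q.1 : ℂ)‖ ≤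
            A * (Real.log (Real.log (Real.log (x : ℝ)))) ^ ((k : ℝ) * (z.re - 1)) * Real.exp (C * ‖(z : ℂ) - 1‖ * Real.log (‖(z : ℂ) - 1‖ + 2)) ∧
          ∑ q ∈ ι, ‖c q‖ / (q.1 : ℝ) ≤
            (Real.log (Real.log (Real.log (x : ℝ)))) ^ ((k : ℝ) * (‖z‖ - 1)) * Real.exp (C * (‖z‖ + 1)) := by
  intro k f hf
  classical
  -- `m₀`: beyond it every `f_i(n) ≥ 1`
  obtain ⟨m₀, hm₀⟩ : ∃ m₀ : ℕ, ∀ n, m₀ ≤ n → ∀ i, 1 ≤ (f i).eval (n : ℤ) := by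
    have h : ∀ᶠ n : ℕ in Filter.atTop, ∀ i, 1 ≤ (f i).eval (n : ℤ) := by
      rw [Filter.eventually_all]
      intro i
      filter_upwards [Literature.NumberTheory.Sieve.eventually_eval_natCast_pos
        (hf.natDegree_pos i) (hf.leadingCoeff_pos i)] with n hn
      omega
    obtain ⟨m₀, hm₀⟩ := Filter.eventually_atTop.1 h
    exact ⟨m₀, hm₀⟩
  -- Stage B constants
  obtain ⟨A, C, Y₀, hB⟩ := stub_eulerProductBounds stub_localFactorLaw k f hf
  -- the capped statistic and the size of its tail below `m₀`
  set s : ℕ → ℕ := fun n => ∑ i, (((f i).eval (n : ℤ)).toNat.factorization.sum fun _ v => min v 2)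
    with hs_def
  set σ : ℕ := ∑ n ∈ range m₀, s n with hσ_def
  set L₀ : ℝ := max (max 1 Y₀) (6 * ((m₀ : ℝ) + 3 * σ + 3 * k)) with hL₀_def
  refine ⟨m₀, A, C, ⌈Real.exp (Real.exp L₀)⌉₊, fun x hx z hz => ?_⟩
  -- size of `x` and of `L = log log x`
  have hxexp : Real.exp (Real.exp L₀) ≤ x := (Nat.le_ceil _).trans (by exact_mod_cast hx)
  have hx1 : (1 : ℝ) < x := lt_of_lt_of_le (by
    have := Real.add_one_le_exp (Real.exp L₀)
    linarith [Real.exp_pos L₀]) hxexp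
  set L : ℝ := Real.log (Real.log x) with hL_def
  have hL0L : L₀ ≤ L := by
    have h1 := Real.log_le_log (Real.exp_pos _) hxexp
    rw [Real.log_exp] at h1
    have h2 := Real.log_le_log (Real.exp_pos _) h1
    rwa [Real.log_exp] at h2
  have hL1 : 1 ≤ L := le_trans (le_trans (le_max_left _ _) (le_max_left _ _)) hL0L
  have hLY : Y₀ ≤ L := le_trans (le_trans (le_max_right _ _) (le_max_left _ _)) hL0L
  have hL6 : 6 * ((m₀ : ℝ) + 3 * σ + 3 * k) ≤ L := le_trans (le_max_right _ _) hL0L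
  have hm₀x : m₀ ≤ x + 1 := by
    have h1 : (m₀ : ℝ) ≤ L₀ := le_trans (by
      have : (0 : ℝ) ≤ σ := Nat.cast_nonneg σ
      have : (0 : ℝ) ≤ k := Nat.cast_nonneg k
      linarith) (le_max_right _ _)
    have h2 : L₀ ≤ Real.exp (Real.exp L₀) := by
      have := Real.add_one_le_exp L₀
      have := Real.add_one_le_exp (Real.exp L₀)
      linarith
    have h3 : (m₀ : ℝ) ≤ x := h1.trans (h2.trans hxexp)
    exact_mod_cast h3.trans (by linarith : (x : ℝ) ≤ x + 1)
  -- the smooth objects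
  set y : ℕ := ⌊L⌋₊ with hy_def
  set Q : ℕ := ∏ p ∈ Nat.primesLE y, p ^ 2 with hQ_def
  set πp : ℕ → ℕ → ℕ := fun p b => ∑ i, ((if (p : ℤ) ∣ (f i).eval (b : ℤ) then 1 else 0) +
    (if (p : ℤ) ^ 2 ∣ (f i).eval (b : ℤ) then 1 else 0)) with hπp_def
  set sm : ℕ → ℕ := fun n => ∑ p ∈ Nat.primesLE y, πp p n with hsm_def
  set sr : ℕ → ℕ := fun n => ∑ i, (((f i).eval (n : ℤ)).toNat.factorization.sum
    fun p v => if L < (p : ℝ) then min v 2 else 0) with hsr_def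
  have hQpos : 0 < Q := prod_pos fun p hp => pow_pos (Nat.mem_primesLE.1 hp).2.pos 2
  have hper : ∀ n, sm n = sm (n % Q) := by
    intro n
    simp only [hsm_def, hπp_def]
    refine sum_congr rfl fun p hp => locPat_mod f ?_ n
    rw [hQ_def]; push_cast
    exact dvd_prod_of_mem (fun p : ℕ => (p : ℤ) ^ 2) hp
  have hsplit : ∀ n, m₀ ≤ n → s n = sm n + sr n := by
    intro n hn
    simp only [hs_def, hsm_def, hsr_def, hπp_def]
    rw [sum_comm, ← sum_add_distrib]
    refine sum_congr rfl fun i _ => ?_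
    have h1 := hm₀ n hn i
    set N : ℕ := ((f i).eval (n : ℤ)).toNat with hN_def
    have hNz : (N : ℤ) = (f i).eval (n : ℤ) := Int.toNat_of_nonneg (by omega)
    have hN0 : N ≠ 0 := by omega
    rw [factorization_sum_split hN0 L]
    congr 1
    refine sum_congr rfl fun p _ => ?_
    have e1 : p ∣ N ↔ (p : ℤ) ∣ (f i).eval (n : ℤ) := by rw [← hNz, Int.natCast_dvd_natCast]
    have e2 : p ^ 2 ∣ N ↔ (p : ℤ) ^ 2 ∣ (f i).eval (n : ℤ) := by
      rw [← hNz, ← Nat.cast_pow, Int.natCast_dvd_natCast]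
    simp only [e1, e2]
  have hcrt : ∀ {R : Type} [CommSemiring R] (w : R),
      ∑ a ∈ range Q, w ^ sm a = ∏ p ∈ Nat.primesLE y, ∑ b ∈ range (p ^ 2), w ^ πp p b :=
    fun w => crt_euler f y w
  have hinj : Set.InjOn (fun a : ℕ => (Q, a)) (range Q : Set ℕ) :=
    fun a _ b _ h => (Prod.ext_iff.1 h).2
  -- bounds on `z`
  have hzB : ‖z‖ ≤ 1 + 3 * L := by
    have : ‖z‖ ≤ ‖z - 1‖ + ‖(1 : ℂ)‖ := by
      simpa using norm_add_le (z - 1) (1 : ℂ)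
    rw [norm_one] at this
    linarith
  have hre : -(3 * L) ≤ z.re - 1 := by
    have h1 := Complex.abs_re_le_norm (z - 1)
    rw [Complex.sub_re, Complex.one_re] at h1
    have := (abs_le.1 h1).1
    linarith
  refine ⟨(range Q).image (fun a => (Q, a)), fun q => z ^ sm q.2, ?_, ?_, ?_, ?_⟩
  · -- membership
    intro q hq
    obtain ⟨a, -, rfl⟩ := mem_image.1 hq
    exact ⟨hQpos, dvd_rfl⟩
  · -- (E)
    rw [sum_image hinj]
    show ‖(∑ n ∈ range (x + 1), z ^ s n) - ∑ a ∈ range Q, z ^ sm a *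
      ∑ n ∈ (Ico m₀ (x + 1)).filter (fun n : ℕ => n ≡ a [MOD Q]), z ^ sr n‖ ≤ _
    rw [← sum_Ico_eq_sum_classes hQpos s sm sr hsplit hper z, ← sum_range_add_sum_Ico _ hm₀x,
      add_sub_cancel_right]
    exact (norm_sum_range_pow_le s m₀ (by linarith) hzB).trans (tail_le hx1 hL_def hL1 hL6 hre)
  · -- (Λ)
    rw [sum_image hinj]
    show ‖∑ a ∈ range Q, z ^ sm a / (Q : ℂ)‖ ≤ _
    rw [← sum_div, hcrt z, show ((Q : ℕ) : ℂ) = ∏ p ∈ Nat.primesLE y, (p : ℂ) ^ 2 by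
      rw [hQ_def]; push_cast; rfl, ← prod_div_distrib]
    exact (hB L hLY z).1
  · -- (B)
    rw [sum_image hinj]
    show ∑ a ∈ range Q, ‖z ^ sm a‖ / (Q : ℝ) ≤ _
    simp_rw [norm_pow]
    rw [← sum_div, hcrt ‖z‖, show ((Q : ℕ) : ℝ) = ∏ p ∈ Nat.primesLE y, (p : ℝ) ^ 2 by
      rw [hQ_def]; push_cast; rfl, ← prod_div_distrib]
    exact (hB L hLY z).2

end Summit.Parity.BatemanHorn.Cruxes.SystemZeroRepulsion.SmoothRoughLatticeAcquisition

end
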